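import Summits.BirchSwinnertonDyer.BirchSwinnertonDyer.Theorems.ResidualThetaTransportAtTwoThetaLayerLambdaCongruenceAtTwoCuspSpanCert29
import Summits.BirchSwinnertonDyer.BirchSwinnertonDyer.Theorems.ResidualThetaTransportAtTwoThetaLayerLambdaCongruenceAtTwoCuspSpanCert53
import Summits.BirchSwinnertonDyer.BirchSwinnertonDyer.Theorems.ResidualThetaTransportAtTwoThetaLayerLambdaCongruenceAtTwoCuspSpanCert101
import Summits.BirchSwinnertonDyer.BirchSwinnertonDyer.Theorems.ResidualThetaTransportAtTwoThetaLayerLambdaCongruenceAtTwoCuspSpanCert125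
import Summits.BirchSwinnertonDyer.BirchSwinnertonDyer.Theorems.ResidualThetaTransportAtTwoThetaLayerLambdaCongruenceAtTwoCuspSpanCert169
import Summits.BirchSwinnertonDyer.BirchSwinnertonDyer.Theorems.ResidualThetaTransportAtTwoThetaLayerLambdaCongruenceAtTwoCuspSpanCert181
import HarnessLib

/-!
# Route `ResidualThetaTransportAtTwo`, cruxes Kan⁺ (stmt-BirchSwinnertonDyer-20688) / Kμ⁺ / 21437: the LEVEL TABLE —
# every odd prime-power level `N ≤ 139` with `(ℤ/N)^× = ±⟨4⟩` (Theorem A by `decide`), together with the certificate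
# levels 19, 27, 29, 37, 53, 101, 125, and FLAT on the habitat at all of them

Cell `bsd-wall`, lead prover `bsd-wall-rtt-p3` g9 (2026-08-28). THEOREMS ONLY; `--supports stmt-BirchSwinnertonDyer-20688`;
BSD is not proved by this. `cuspSpanEvenAtTwo_of_mem_levelTable`: the node (G′)_N = `SignedMuAtTwo.CuspSpanEvenAtTwo N` is a
THEOREM for `N ∈ {7, 11, 19, 23, 27, 29, 37, 47, 49, 53, 59, 67, 71, 79, 81, 83, 101, 103, 107, 121, 125, 131, 139}` (every odd
prime power ≤ 139 at which (U4) holds or a B₁-certificate was landed; genus-0 levels 3, 5, 9, 13, 25 omitted as vacuous; NOT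
yet: 17, 31, 41, 43, 61, 73, 89, 97, 109, 113, 127, 137, and every level with two odd prime factors).
`flatAtTwo_of_conductor_mem_levelTable`: FLAT (`2 ∤ L⁻` for every Pollack pair at 2) for every `W` good supersingular at 2
with `a₂ = 0` whose conductor is in the table.

References: [Rademacher1929]; [Pollack2003] Conj. 6.3, Prop. 6.18.
-/

set_option autoImplicit false
set_option linter.dupNamespace false

noncomputable section

open scoped MatrixGroups

open CongruenceSubgroup WeierstrassCurve Literature.NumberTheory.EllipticCurves
  Literature.NumberTheory.EllipticCurves.ModularForms Literature.NumberTheory.EllipticCurves.Rank1Residual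
  Literature.NumberTheory.IwasawaTheory Summit.BirchSwinnertonDyer.Rank1Residual.Supersingular

namespace Summit.BirchSwinnertonDyer.BirchSwinnertonDyer.Theorems.SignedMuAtTwo

set_option maxRecDepth 16384 in
/-- `CuspSpanEvenAtTwo 7` (Theorem A: `7 = 7^1`, every unit of `ℤ/7` is `±4^k`, `k ≤ 3`). [cite: Pollack2003, Conj. 6.3] -/
theorem cuspSpanEvenAtTwo_seven : CuspSpanEvenAtTwo 7 := by
  have h : CuspSpanEvenAtTwo (7 ^ 1) :=
    cuspSpanEvenAtTwo_of_primePow_of_finiteCheck (p := 7) (e := 1) (by norm_num) 3 (by decide)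
  simpa using h

set_option maxRecDepth 16384 in
/-- `CuspSpanEvenAtTwo 11` (Theorem A: `11 = 11^1`, every unit of `ℤ/11` is `±4^k`, `k ≤ 5`). [cite: Pollack2003, Conj. 6.3] -/
theorem cuspSpanEvenAtTwo_eleven : CuspSpanEvenAtTwo 11 := by
  have h : CuspSpanEvenAtTwo (11 ^ 1) :=
    cuspSpanEvenAtTwo_of_primePow_of_finiteCheck (p := 11) (e := 1) (by norm_num) 5 (by decide)
  simpa using h

set_option maxRecDepth 16384 in
/-- `CuspSpanEvenAtTwo 23` (Theorem A: `23 = 23^1`, every unit of `ℤ/23` is `±4^k`, `k ≤ 11`). [cite: Pollack2003, Conj. 6.3] -/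
theorem cuspSpanEvenAtTwo_twentythree : CuspSpanEvenAtTwo 23 := by
  have h : CuspSpanEvenAtTwo (23 ^ 1) :=
    cuspSpanEvenAtTwo_of_primePow_of_finiteCheck (p := 23) (e := 1) (by norm_num) 11 (by decide)
  simpa using h

set_option maxRecDepth 16384 in
/-- `CuspSpanEvenAtTwo 47` (Theorem A: `47 = 47^1`, every unit of `ℤ/47` is `±4^k`, `k ≤ 23`). [cite: Pollack2003, Conj. 6.3] -/
theorem cuspSpanEvenAtTwo_fortyseven : CuspSpanEvenAtTwo 47 := by
  have h : CuspSpanEvenAtTwo (47 ^ 1) :=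
    cuspSpanEvenAtTwo_of_primePow_of_finiteCheck (p := 47) (e := 1) (by norm_num) 23 (by decide)
  simpa using h

set_option maxRecDepth 16384 in
/-- `CuspSpanEvenAtTwo 49` (Theorem A: `49 = 7^2`, every unit of `ℤ/49` is `±4^k`, `k ≤ 21`). [cite: Pollack2003, Conj. 6.3] -/
theorem cuspSpanEvenAtTwo_fortynine : CuspSpanEvenAtTwo 49 := by
  have h : CuspSpanEvenAtTwo (7 ^ 2) :=
    cuspSpanEvenAtTwo_of_primePow_of_finiteCheck (p := 7) (e := 2) (by norm_num) 21 (by decide)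
  simpa using h

set_option maxRecDepth 16384 in
/-- `CuspSpanEvenAtTwo 59` (Theorem A: `59 = 59^1`, every unit of `ℤ/59` is `±4^k`, `k ≤ 29`). [cite: Pollack2003, Conj. 6.3] -/
theorem cuspSpanEvenAtTwo_fiftynine : CuspSpanEvenAtTwo 59 := by
  have h : CuspSpanEvenAtTwo (59 ^ 1) :=
    cuspSpanEvenAtTwo_of_primePow_of_finiteCheck (p := 59) (e := 1) (by norm_num) 29 (by decide)
  simpa using h

set_option maxRecDepth 16384 in
/-- `CuspSpanEvenAtTwo 67` (Theorem A: `67 = 67^1`, every unit of `ℤ/67` is `±4^k`, `k ≤ 33`). [cite: Pollack2003, Conj. 6.3] -/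
theorem cuspSpanEvenAtTwo_sixtyseven : CuspSpanEvenAtTwo 67 := by
  have h : CuspSpanEvenAtTwo (67 ^ 1) :=
    cuspSpanEvenAtTwo_of_primePow_of_finiteCheck (p := 67) (e := 1) (by norm_num) 33 (by decide)
  simpa using h

set_option maxRecDepth 16384 in
/-- `CuspSpanEvenAtTwo 71` (Theorem A: `71 = 71^1`, every unit of `ℤ/71` is `±4^k`, `k ≤ 35`). [cite: Pollack2003, Conj. 6.3] -/
theorem cuspSpanEvenAtTwo_seventyone : CuspSpanEvenAtTwo 71 := by
  have h : CuspSpanEvenAtTwo (71 ^ 1) :=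
    cuspSpanEvenAtTwo_of_primePow_of_finiteCheck (p := 71) (e := 1) (by norm_num) 35 (by decide)
  simpa using h

set_option maxRecDepth 16384 in
/-- `CuspSpanEvenAtTwo 79` (Theorem A: `79 = 79^1`, every unit of `ℤ/79` is `±4^k`, `k ≤ 39`). [cite: Pollack2003, Conj. 6.3] -/
theorem cuspSpanEvenAtTwo_seventynine : CuspSpanEvenAtTwo 79 := by
  have h : CuspSpanEvenAtTwo (79 ^ 1) :=
    cuspSpanEvenAtTwo_of_primePow_of_finiteCheck (p := 79) (e := 1) (by norm_num) 39 (by decide)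
  simpa using h

set_option maxRecDepth 16384 in
/-- `CuspSpanEvenAtTwo 81` (Theorem A: `81 = 3^4`, every unit of `ℤ/81` is `±4^k`, `k ≤ 27`). [cite: Pollack2003, Conj. 6.3] -/
theorem cuspSpanEvenAtTwo_eightyone : CuspSpanEvenAtTwo 81 := by
  have h : CuspSpanEvenAtTwo (3 ^ 4) :=
    cuspSpanEvenAtTwo_of_primePow_of_finiteCheck (p := 3) (e := 4) (by norm_num) 27 (by decide)
  simpa using h

set_option maxRecDepth 16384 in
/-- `CuspSpanEvenAtTwo 83` (Theorem A: `83 = 83^1`, every unit of `ℤ/83` is `±4^k`, `k ≤ 41`). [cite: Pollack2003, Conj. 6.3] -/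
theorem cuspSpanEvenAtTwo_eightythree : CuspSpanEvenAtTwo 83 := by
  have h : CuspSpanEvenAtTwo (83 ^ 1) :=
    cuspSpanEvenAtTwo_of_primePow_of_finiteCheck (p := 83) (e := 1) (by norm_num) 41 (by decide)
  simpa using h

set_option maxRecDepth 16384 in
/-- `CuspSpanEvenAtTwo 103` (Theorem A: `103 = 103^1`, every unit of `ℤ/103` is `±4^k`, `k ≤ 51`). [cite: Pollack2003, Conj. 6.3] -/
theorem cuspSpanEvenAtTwo_hundredthree : CuspSpanEvenAtTwo 103 := by
  have h : CuspSpanEvenAtTwo (103 ^ 1) :=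
    cuspSpanEvenAtTwo_of_primePow_of_finiteCheck (p := 103) (e := 1) (by norm_num) 51 (by decide)
  simpa using h

set_option maxRecDepth 16384 in
/-- `CuspSpanEvenAtTwo 107` (Theorem A: `107 = 107^1`, every unit of `ℤ/107` is `±4^k`, `k ≤ 53`). [cite: Pollack2003, Conj. 6.3] -/
theorem cuspSpanEvenAtTwo_hundredseven : CuspSpanEvenAtTwo 107 := by
  have h : CuspSpanEvenAtTwo (107 ^ 1) :=
    cuspSpanEvenAtTwo_of_primePow_of_finiteCheck (p := 107) (e := 1) (by norm_num) 53 (by decide)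
  simpa using h

set_option maxRecDepth 16384 in
/-- `CuspSpanEvenAtTwo 121` (Theorem A: `121 = 11^2`, every unit of `ℤ/121` is `±4^k`, `k ≤ 55`). [cite: Pollack2003, Conj. 6.3] -/
theorem cuspSpanEvenAtTwo_hundredtwentyone : CuspSpanEvenAtTwo 121 := by
  have h : CuspSpanEvenAtTwo (11 ^ 2) :=
    cuspSpanEvenAtTwo_of_primePow_of_finiteCheck (p := 11) (e := 2) (by norm_num) 55 (by decide)
  simpa using h

set_option maxRecDepth 16384 in
/-- `CuspSpanEvenAtTwo 131` (Theorem A: `131 = 131^1`, every unit of `ℤ/131` is `±4^k`, `k ≤ 65`). [cite: Pollack2003, Conj. 6.3] -/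
theorem cuspSpanEvenAtTwo_hundredthirtyone : CuspSpanEvenAtTwo 131 := by
  have h : CuspSpanEvenAtTwo (131 ^ 1) :=
    cuspSpanEvenAtTwo_of_primePow_of_finiteCheck (p := 131) (e := 1) (by norm_num) 65 (by decide)
  simpa using h

set_option maxRecDepth 16384 in
/-- `CuspSpanEvenAtTwo 139` (Theorem A: `139 = 139^1`, every unit of `ℤ/139` is `±4^k`, `k ≤ 69`). [cite: Pollack2003, Conj. 6.3] -/
theorem cuspSpanEvenAtTwo_hundredthirtynine : CuspSpanEvenAtTwo 139 := by
  have h : CuspSpanEvenAtTwo (139 ^ 1) :=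
    cuspSpanEvenAtTwo_of_primePow_of_finiteCheck (p := 139) (e := 1) (by norm_num) 69 (by decide)
  simpa using h

/-- **The level table.** `CuspSpanEvenAtTwo N` for every `N` in
`{7, 11, 19, 23, 27, 29, 37, 47, 49, 53, 59, 67, 71, 79, 81, 83, 101, 103, 107, 121, 125, 131, 139}`. [cite: Pollack2003, Conj. 6.3] -/
theorem cuspSpanEvenAtTwo_of_mem_levelTable {N : ℕ} [NeZero N]
    (hN : N ∈ ({7, 11, 19, 23, 27, 29, 37, 47, 49, 53, 59, 67, 71, 79, 81, 83, 101, 103, 107, 121, 125, 131, 139} :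
      Finset ℕ)) :
    CuspSpanEvenAtTwo N := by
  simp only [Finset.mem_insert, Finset.mem_singleton] at hN
  rcases hN with rfl | rfl | rfl | rfl | rfl | rfl | rfl | rfl | rfl | rfl | rfl | rfl | rfl | rfl | rfl | rfl | rfl | rfl | rfl |
    rfl | rfl | rfl | rfl
  exacts [cuspSpanEvenAtTwo_seven, cuspSpanEvenAtTwo_eleven, cuspSpanEvenAtTwo_nineteen,
    cuspSpanEvenAtTwo_twentythree, cuspSpanEvenAtTwo_twentyseven, cuspSpanEvenAtTwo_twentynine,
    cuspSpanEvenAtTwo_thirtyseven, cuspSpanEvenAtTwo_fortyseven, cuspSpanEvenAtTwo_fortynine,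
    cuspSpanEvenAtTwo_fiftythree, cuspSpanEvenAtTwo_fiftynine, cuspSpanEvenAtTwo_sixtyseven,
    cuspSpanEvenAtTwo_seventyone, cuspSpanEvenAtTwo_seventynine, cuspSpanEvenAtTwo_eightyone,
    cuspSpanEvenAtTwo_eightythree, cuspSpanEvenAtTwo_hundredone, cuspSpanEvenAtTwo_hundredthree,
    cuspSpanEvenAtTwo_hundredseven, cuspSpanEvenAtTwo_hundredtwentyone, cuspSpanEvenAtTwo_hundredtwentyfive,
    cuspSpanEvenAtTwo_hundredthirtyone, cuspSpanEvenAtTwo_hundredthirtynine]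

/-- **FLAT at every conductor in the level table**: for `W/ℚ` good supersingular at `2` with `a₂(W) = 0` and `N_W` in the table,
`2 ∤ L⁻` for every Pollack pair of its newform at `2` (rtt-p4's `flatAtTwo_of_cuspSpanEvenAtTwo` + the table).
BSD is not proved by this. [cite: Pollack2003, Conj. 6.3 and Prop. 6.18] -/
theorem flatAtTwo_of_conductor_mem_levelTable {W : WeierstrassCurve ℚ} [W.IsElliptic] [W.IsGloballyMinimal]
    [NeZero (W.conductorNorm ℤ)] {f : CuspForm (Gamma0 (W.conductorNorm ℤ)) 2}
    (hf : IsNewformOf W f) (hss : GoodSS W 2) (ha : W.frobeniusTrace 2 = 0)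
    (hN : W.conductorNorm ℤ ∈
      ({7, 11, 19, 23, 27, 29, 37, 47, 49, 53, 59, 67, 71, 79, 81, 83, 101, 103, 107, 121, 125, 131, 139} : Finset ℕ)) :
    ∀ Lplus Lminus : IwasawaAlgebra 2, IsPollackPair f 2 Lplus Lminus → ¬ PowerSeries.C (2 : ℤ_[2]) ∣ Lminus :=
  flatAtTwo_of_cuspSpanEvenAtTwo hf hss ha (cuspSpanEvenAtTwo_of_mem_levelTable hN)

/-- **The level table, extended (2026-08-28, + 169, 181).** `CuspSpanEvenAtTwo N` for every `N` in
`{7, 11, 19, 23, 27, 29, 37, 47, 49, 53, 59, 67, 71, 79, 81, 83, 101, 103, 107, 121, 125, 131, 139, 169, 181}`. [cite: Pollack2003, Conj. 6.3] -/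
theorem cuspSpanEvenAtTwo_of_mem_levelTable_ext {N : ℕ} [NeZero N]
    (hN : N ∈ ({7, 11, 19, 23, 27, 29, 37, 47, 49, 53, 59, 67, 71, 79, 81, 83, 101, 103, 107, 121, 125, 131, 139, 169, 181} :
      Finset ℕ)) :
    CuspSpanEvenAtTwo N := by
  simp only [Finset.mem_insert, Finset.mem_singleton] at hN
  rcases hN with rfl | rfl | rfl | rfl | rfl | rfl | rfl | rfl | rfl | rfl | rfl | rfl | rfl | rfl | rfl | rfl | rfl | rfl | rfl |
    rfl | rfl | rfl | rfl | rfl | rfl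
  exacts [cuspSpanEvenAtTwo_seven, cuspSpanEvenAtTwo_eleven, cuspSpanEvenAtTwo_nineteen,
    cuspSpanEvenAtTwo_twentythree, cuspSpanEvenAtTwo_twentyseven, cuspSpanEvenAtTwo_twentynine,
    cuspSpanEvenAtTwo_thirtyseven, cuspSpanEvenAtTwo_fortyseven, cuspSpanEvenAtTwo_fortynine,
    cuspSpanEvenAtTwo_fiftythree, cuspSpanEvenAtTwo_fiftynine, cuspSpanEvenAtTwo_sixtyseven,
    cuspSpanEvenAtTwo_seventyone, cuspSpanEvenAtTwo_seventynine, cuspSpanEvenAtTwo_eightyone,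
    cuspSpanEvenAtTwo_eightythree, cuspSpanEvenAtTwo_hundredone, cuspSpanEvenAtTwo_hundredthree,
    cuspSpanEvenAtTwo_hundredseven, cuspSpanEvenAtTwo_hundredtwentyone, cuspSpanEvenAtTwo_hundredtwentyfive,
    cuspSpanEvenAtTwo_hundredthirtyone, cuspSpanEvenAtTwo_hundredthirtynine, cuspSpanEvenAtTwo_hundredsixtynine,
    cuspSpanEvenAtTwo_hundredeightyone]

/-- **FLAT at every conductor in the extended level table.** BSD is not proved by this. [cite: Pollack2003, Conj. 6.3 and Prop. 6.18] -/
theorem flatAtTwo_of_conductor_mem_levelTable_ext {W : WeierstrassCurve ℚ} [W.IsElliptic] [W.IsGloballyMinimal]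
    [NeZero (W.conductorNorm ℤ)] {f : CuspForm (Gamma0 (W.conductorNorm ℤ)) 2}
    (hf : IsNewformOf W f) (hss : GoodSS W 2) (ha : W.frobeniusTrace 2 = 0)
    (hN : W.conductorNorm ℤ ∈
      ({7, 11, 19, 23, 27, 29, 37, 47, 49, 53, 59, 67, 71, 79, 81, 83, 101, 103, 107, 121, 125, 131, 139, 169, 181} : Finset ℕ)) :
    ∀ Lplus Lminus : IwasawaAlgebra 2, IsPollackPair f 2 Lplus Lminus → ¬ PowerSeries.C (2 : ℤ_[2]) ∣ Lminus :=
  flatAtTwo_of_cuspSpanEvenAtTwo hf hss ha (cuspSpanEvenAtTwo_of_mem_levelTable_ext hN)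

end Summit.BirchSwinnertonDyer.BirchSwinnertonDyer.Theorems.SignedMuAtTwo

end
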